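import Literature.AnabelianGeometry.SemiGraphs.PSCCoveringDatumVertexDictionary
import Literature.AnabelianGeometry.SemiGraphs.PSCVertexQuotientExistenceProofs
import Literature.AnabelianGeometry.SemiGraphs.PSCCoveringDatumSturdy
import Literature.AnabelianGeometry.SemiGraphs.PSCUnrVerticialNecessityProofs
import HarnessLib

/-!
# [IUTchI] Rmk. 1.2.3 (iv) applied functorially: the vertex-STABILIZER characterization at every level

Mochizuki, *Inter-universal Teichmüller theory I*, Remark 1.2.3 (iv), kurims manuscript p. 42 — "it
suffices — by considering stabilizers of vertices of underlying semi-graphs of finite étale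
`Π^unr_G`-coverings of `G` — to give a functorial characterization of the set of vertices of `G` [i.e., a
characterization which may also be applied to finite étale `Π^unr_G`-coverings of `G`]" followed by
that characterization ("the set of [nontrivial!] quotients `M^unr-vert_G ↠ M^unr_G[v] ⊗ F_l`", "the
maximal quotients … among those elementary abelian quotients of `M^unr_G` that correspond to
verticially purely totally ramified coverings") — and Remark 1.2.3 (vii), p. 43: necessity in
[CombGC] Thm. 1.6 (iii) "follows formally" from it.

This proof-only file (abc-iut cell, row CombGC:Thm1.6(iii)/T16-L16) DISCHARGES the binder `hVC` of the
landed assembly `PSCUnrVerticialNecessityProofs` (GAP-LEDGER G-w5d174-1) — "a subgroup `S ⊇ U` is the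
stabilizer `U · Π_v^γ` of a vertex of `G_U` iff `S` is the normalizer of `vertFil U ∩ H'` for a kernel
`H'` of a nontrivial elementary abelian quotient of `M^unr_{G_U}` maximal among the verticially purely
totally ramified ones" — from abc-iut-w4-d052's TYPED predicates `VertexQuotientCharacterization`,
`VertexSetCharacterization`, `UnrVerticialSplitInjection`, `UnrVertAbOfRank` APPLIED TO THE COVERING
DATA `G.restrict U hU` (abc-iut-L3-t4), i.e. from [IUTchI] Rmk. 1.2.3 (iv) applied functorially, via:
the `Π_G`-equivariance of `w ↦ K_w` and "stabilizer = normalizer" (`PSCVertexKernelStabilizerProofs`),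
the existence of the quotient `φ_w` (`PSCVertexQuotientExistenceProofs`), and the dictionary
`PSCCoveringDatumVertexDictionary` / `PSCCoveringDatumRamificationProofs`.

* `vertexStabilizer_iff_of_restrict` — the characterization at one level `U`;
* `vertexStabilizerCharacterization_levels_of_restrict` — the binder `hVC` verbatim, for profinite
  `Π_G`, from the four typed predicates on all covering data `G_U`, `U ⊇ Ker` a level.

0 defs; nothing here takes a side on [IUTchIII] Cor. 3.12. [cite: Mochizuki2012, IUTchI Rmk 1.2.3(iv) p.42]
[cite: Mochizuki2012, IUTchI Rmk 1.2.3(vii) p.43]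
-/

noncomputable section

namespace Literature.AnabelianGeometry.SemiGraphs

namespace PSCDatum

open scoped Pointwise
open PSCCovering

universe u

variable {P : Type u} [Group P] [TopologicalSpace P] [IsTopologicalGroup P] [CompactSpace P]
  [T2Space P]

/-! ### 1. The dictionary for kernels and maximality -/

section Level

variable (G : PSCDatum P) (U : Subgroup P) [U.FiniteIndex] (hU : IsOpen (U : Set P))

omit [CompactSpace P] [T2Space P] in
/-- The binder shape "kernel of a nontrivial elementary abelian quotient of `M^unr_{G_U}`" ↔
`IsElemAbUnrQuotient` for the datum `G_U` plus `H' ≠ U`. [cite: Mochizuki2012, IUTchI Rmk 1.2.3(iv) p.42] -/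
theorem elemAbKernel_iff_restrict (hKU : G.unrKer ≤ U) {l : ℕ} {H' : Subgroup P} :
    (H' ≤ U ∧ H' ≠ U ∧ IsOpen (H' : Set P) ∧ (⁅U, U⁆ ⊔ G.unrKer).topologicalClosure ≤ H' ∧
        ∀ u ∈ U, u ^ l ∈ H') ↔
      (H' ≤ U ∧ (G.restrict U hU).IsElemAbUnrQuotient l (H'.subgroupOf U) ∧ H' ≠ U) := by
  constructor
  · rintro ⟨hle, hne, hopen, hcl, hpow⟩
    refine ⟨hle, (G.isElemAbUnrQuotient_restrict_iff U hU hKU hle).mpr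
      ⟨subgroupOf_normal_of_commutator_le ((le_sup_left.trans (Subgroup.le_topologicalClosure _)).trans
        hcl), hopen, hcl, hpow⟩, hne⟩
  · rintro ⟨hle, hq, hne⟩
    obtain ⟨-, hopen, hcl, hpow⟩ := (G.isElemAbUnrQuotient_restrict_iff U hU hKU hle).mp hq
    exact ⟨hle, hne, hopen, hcl, hpow⟩

omit [TopologicalSpace P] [IsTopologicalGroup P] [CompactSpace P] [T2Space P] [U.FiniteIndex] in
/-- A subgroup of `U` (as a subgroup of `↥U`) is the trace of its image. [folklore] -/
private theorem subgroupOf_map_subtype_eq (V : Subgroup U) : (V.map U.subtype).subgroupOf U = V :=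
  Subgroup.comap_map_eq_self_of_injective U.subtype_injective V

omit [CompactSpace P] [T2Space P] in
/-- Maximality among the verticially purely totally ramified kernels: binder shape (in `G`) ↔ datum
shape (in `G_U`), for a kernel `H' ⊊ U`. [cite: Mochizuki2012, IUTchI Rmk 1.2.3(iv) p.42] -/
theorem vptrMaximal_iff_restrict (hKU : G.unrKer ≤ U) {l : ℕ} {H' : Subgroup P} (hle : H' ≤ U) :
    (∀ H'' : Subgroup P,
        (H'' ≤ U ∧ H'' ≠ U ∧ IsOpen (H'' : Set P) ∧ (⁅U, U⁆ ⊔ G.unrKer).topologicalClosure ≤ H'' ∧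
          ∀ u ∈ U, u ^ l ∈ H'') →
        G.IsVerticiallyPurelyTotallyRamified U H'' → H'' ≤ H' → H'' = H') ↔
      ∀ H₂ : Subgroup U, (G.restrict U hU).IsElemAbUnrQuotient l H₂ →
        (G.restrict U hU).IsVerticiallyPurelyTotallyRamified ⊤ H₂ → H₂ ≤ H'.subgroupOf U →
        H₂ = H'.subgroupOf U := by
  constructor
  · intro h H₂ hq hv hle₂
    by_cases htop : H₂ = ⊤
    · subst htop
      exact le_antisymm hle₂ le_top
    · have hle' : H₂.map U.subtype ≤ U := Subgroup.map_subtype_le H₂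
      have hne' : H₂.map U.subtype ≠ U := by
        intro hEq
        apply htop
        rw [← subgroupOf_map_subtype_eq U H₂, hEq, Subgroup.subgroupOf_self]
      have hE : H₂.map U.subtype ≤ U ∧ H₂.map U.subtype ≠ U ∧ IsOpen ((H₂.map U.subtype : Subgroup P) :
          Set P) ∧ (⁅U, U⁆ ⊔ G.unrKer).topologicalClosure ≤ H₂.map U.subtype ∧
          ∀ u ∈ U, u ^ l ∈ H₂.map U.subtype := by
        refine (G.elemAbKernel_iff_restrict U hU hKU).mpr ⟨hle', ?_, hne'⟩
        rw [subgroupOf_map_subtype_eq]; exact hq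
      have hV : G.IsVerticiallyPurelyTotallyRamified U (H₂.map U.subtype) := by
        rw [← G.isVerticiallyPurelyTotallyRamified_restrict_iff hU hle', subgroupOf_map_subtype_eq]
        exact hv
      have hle₃ : H₂.map U.subtype ≤ H' :=
        (Subgroup.map_mono hle₂).trans (by rw [Subgroup.subgroupOf_map_subtype]; exact inf_le_left)
      have := h _ hE hV hle₃
      rw [← subgroupOf_map_subtype_eq U H₂, this]
  · intro h H'' hE hV hle''
    obtain ⟨hle₂, hq, -⟩ := (G.elemAbKernel_iff_restrict U hU hKU).mp hE
    have hv := (G.isVerticiallyPurelyTotallyRamified_restrict_iff hU hle₂).mpr hV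
    have := h _ hq hv (Subgroup.comap_mono hle'')
    have h1 := congrArg (Subgroup.map U.subtype) this
    rwa [Subgroup.subgroupOf_map_subtype, Subgroup.subgroupOf_map_subtype, inf_eq_left.mpr hle₂,
      inf_eq_left.mpr hle] at h1

/-! ### 2. The vertex-stabilizer characterization at the level `U` -/

/-- **[IUTchI] Rmk. 1.2.3 (iv) applied to the covering `G_U` and read on stabilizers** (the binder
`hVC` of `PSCUnrVerticialNecessityProofs` at one level `U`): for a level `U ⊇ Ker(Π_G ↠ Π^unr_G)`
(open normal) such that the datum `G_U` is sturdy and satisfies, with `Σ = {l}`, abc-iut-w4-d052's typed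
`VertexQuotientCharacterization`, `VertexSetCharacterization`, `UnrVerticialSplitInjection`,
`UnrVertAbOfRank`: a subgroup `S` of `Π_G` is a vertex stabilizer `U · Π_v^γ` of `G_U` iff `S` is the
normalizer of `vertFil U ∩ H'` for a kernel `H' ⊊ U` of an elementary abelian quotient of `M^unr_{G_U}`
which is maximal among the verticially purely totally ramified ones.
[cite: Mochizuki2012, IUTchI Rmk 1.2.3(iv) p.42] -/
theorem vertexStabilizer_iff_of_restrict (hUn : U.Normal) (hKU : G.unrKer ≤ U)
    (hDs : (G.restrict U hU).IsSturdy) {l : ℕ} (hl : G.Sigma = {l})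
    (hVQ : (G.restrict U hU).VertexQuotientCharacterization)
    (hVS : (G.restrict U hU).VertexSetCharacterization)
    (hSI : (G.restrict U hU).UnrVerticialSplitInjection) (hRK : (G.restrict U hU).UnrVertAbOfRank)
    (S : Subgroup P) :
    (∃ (v : G.graph.V) (γ : ConjAct P), S = U ⊔ γ • G.vertGp v) ↔
      ∃ H' : Subgroup P,
        (H' ≤ U ∧ H' ≠ U ∧ IsOpen (H' : Set P) ∧ (⁅U, U⁆ ⊔ G.unrKer).topologicalClosure ≤ H' ∧
          ∀ u ∈ U, u ^ l ∈ H') ∧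
        (G.IsVerticiallyPurelyTotallyRamified U H' ∧ ∀ H'' : Subgroup P,
          (H'' ≤ U ∧ H'' ≠ U ∧ IsOpen (H'' : Set P) ∧ (⁅U, U⁆ ⊔ G.unrKer).topologicalClosure ≤ H'' ∧
            ∀ u ∈ U, u ^ l ∈ H'') →
          G.IsVerticiallyPurelyTotallyRamified U H'' → H'' ≤ H' → H'' = H') ∧
        S = Subgroup.normalizer ((G.vertFil U ⊓ H' : Subgroup P) : Set P) := by
  have hlD : (G.restrict U hU).Sigma = {l} := by rw [restrict_Sigma, hl]
  have hlP : l.Prime := G.sigma_prime l (by rw [hl]; exact Set.mem_singleton l)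
  have hlS : l ∈ (G.restrict U hU).Sigma := by rw [hlD]; exact Set.mem_singleton l
  obtain ⟨hinj, hnontriv⟩ := hVS hDs l hlD
  haveI : CompactSpace U :=
    isCompact_iff_compactSpace.mp (Subgroup.isClosed_of_isOpen U hU).isCompact
  constructor
  · rintro ⟨v, γ, hS⟩
    -- the vertex `w = U γ Π_v` of `G_U` and its quotient `φ_w`
    set j := dcIdx U (G.vertGp v) (ConjAct.ofConjAct γ) with hj
    have hne : Nonempty (G.restrictGraph U).V := ⟨⟨v, j⟩⟩
    obtain ⟨H₁, hq, hsup, hinf⟩ :=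
      (G.restrict U hU).exists_isElemAbUnrQuotient_inf_eq_vertexQuotientKer hSI hRK hDs hlP hlS ⟨v, j⟩
    obtain ⟨hvD, hmaxD⟩ := (hVQ hDs l hlD H₁ hq).mp ⟨⟨v, j⟩, hsup, hinf⟩
    have hle : H₁.map U.subtype ≤ U := Subgroup.map_subtype_le H₁
    have hback : (H₁.map U.subtype).subgroupOf U = H₁ := subgroupOf_map_subtype_eq U H₁
    have hne' : H₁.map U.subtype ≠ U := by
      intro hEq
      apply hnontriv ⟨v, j⟩
      rw [← hinf, ← hback, hEq, Subgroup.subgroupOf_self, inf_top_eq]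
    refine ⟨H₁.map U.subtype, (G.elemAbKernel_iff_restrict U hU hKU).mpr ⟨hle, hback.symm ▸ hq, hne'⟩,
      ⟨(G.isVerticiallyPurelyTotallyRamified_restrict_iff hU hle).mp (hback.symm ▸ hvD),
        (G.vptrMaximal_iff_restrict U hU hKU hle).mpr (hback.symm ▸ hmaxD)⟩, ?_⟩
    rw [hS, G.sup_smul_vertGp_eq_sup_vrep U hUn v γ, ← hj,
      ← normalizer_map_vertexQuotientKer_restrict hU hUn hKU hinj v j, ← hinf, ← hback,
      G.map_subtype_unrVertAb_inf_restrict U hU hne hle, hback]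
  · rintro ⟨H', hE, ⟨hV, hmax⟩, hS⟩
    have hle : H' ≤ U := hE.1
    obtain ⟨v₀, γ₀, -⟩ := hV.2
    have hne : Nonempty (G.restrictGraph U).V := ⟨⟨v₀, dcIdx U (G.vertGp v₀) (ConjAct.ofConjAct γ₀)⟩⟩
    obtain ⟨-, hq, -⟩ := (G.elemAbKernel_iff_restrict U hU hKU).mp hE
    have hvD := (G.isVerticiallyPurelyTotallyRamified_restrict_iff hU hle).mpr hV
    have hmaxD := (G.vptrMaximal_iff_restrict U hU hKU hle).mp hmax
    obtain ⟨⟨v, j⟩, hsup, hinf⟩ := (hVQ hDs l hlD _ hq).mpr ⟨hvD, hmaxD⟩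
    refine ⟨v, ConjAct.toConjAct (G.vrep U ⟨v, j⟩), ?_⟩
    rw [hS, ← G.map_subtype_unrVertAb_inf_restrict U hU hne hle, hinf,
      normalizer_map_vertexQuotientKer_restrict hU hUn hKU hinj v j]

end Level

/-! ### 3. The binder `hVC` of `PSCUnrVerticialNecessityProofs`, and Theorem 1.6 (iii) over covering data -/

section Levels

variable (G : PSCDatum P)

/-- **The binder `hVC` of `PSCUnrVerticialNecessityProofs` (GAP-LEDGER G-w5d174-1), DISCHARGED from
[IUTchI] Rmk. 1.2.3 (iv) applied to every covering datum**: if abc-iut-w4-d052's typed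
`VertexQuotientCharacterization`, `VertexSetCharacterization`, `UnrVerticialSplitInjection`,
`UnrVertAbOfRank` hold for the datum `G_U` of every level `U ⊇ Ker(Π_G ↠ Π^unr_G)`, then the
level-wise vertex-stabilizer characterization holds in exactly the shape consumed there
(profinite `Π_G`; sturdiness of `G_U` from abc-iut-L3-t4's `IsSturdy.restrict`).
[cite: Mochizuki2012, IUTchI Rmk 1.2.3(iv) p.42] -/
theorem vertexStabilizerCharacterization_levels_of_restrict
    (hVQ : ∀ (U : Subgroup P) [U.FiniteIndex] (hU : IsOpen (U : Set P)), G.unrKer ≤ U →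
      (G.restrict U hU).VertexQuotientCharacterization)
    (hVS : ∀ (U : Subgroup P) [U.FiniteIndex] (hU : IsOpen (U : Set P)), G.unrKer ≤ U →
      (G.restrict U hU).VertexSetCharacterization)
    (hSI : ∀ (U : Subgroup P) [U.FiniteIndex] (hU : IsOpen (U : Set P)), G.unrKer ≤ U →
      (G.restrict U hU).UnrVerticialSplitInjection)
    (hRK : ∀ (U : Subgroup P) [U.FiniteIndex] (hU : IsOpen (U : Set P)), G.unrKer ≤ U →
      (G.restrict U hU).UnrVertAbOfRank) :
    G.IsSturdy → ∀ l : ℕ, G.Sigma = {l} → ∀ U : Subgroup P, U.Normal → IsOpen (U : Set P) →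
      G.unrKer ≤ U → ∀ S : Subgroup P, U ≤ S →
      ((∃ (v : G.graph.V) (γ : ConjAct P), S = U ⊔ γ • G.vertGp v) ↔
        ∃ H' : Subgroup P,
          (H' ≤ U ∧ H' ≠ U ∧ IsOpen (H' : Set P) ∧ (⁅U, U⁆ ⊔ G.unrKer).topologicalClosure ≤ H' ∧
            ∀ u ∈ U, u ^ l ∈ H') ∧
          (G.IsVerticiallyPurelyTotallyRamified U H' ∧ ∀ H'' : Subgroup P,
            (H'' ≤ U ∧ H'' ≠ U ∧ IsOpen (H'' : Set P) ∧
                (⁅U, U⁆ ⊔ G.unrKer).topologicalClosure ≤ H'' ∧ ∀ u ∈ U, u ^ l ∈ H'') →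
            G.IsVerticiallyPurelyTotallyRamified U H'' → H'' ≤ H' → H'' = H') ∧
          S = Subgroup.normalizer ((G.vertFil U ⊓ H' : Subgroup P) : Set P)) := by
  intro hG l hl U hUn hUo hKU S _
  haveI : DiscreteTopology (P ⧸ U) := QuotientGroup.discreteTopology hUo
  haveI : Finite (P ⧸ U) := finite_of_compact_of_discrete
  haveI : U.FiniteIndex := Subgroup.finiteIndex_of_finite_quotient
  exact G.vertexStabilizer_iff_of_restrict U hUo hUn hKU (PSCDatum.IsSturdy.restrict G U hUo hG) hl
    (hVQ U hUo hKU) (hVS U hUo hKU) (hSI U hUo hKU) (hRK U hUo hKU) S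

end Levels

section Thm16iii

variable {P' : Type u} [Group P'] [TopologicalSpace P'] [IsTopologicalGroup P'] [CompactSpace P']
  [T2Space P']
variable [TotallyDisconnectedSpace P] [TotallyDisconnectedSpace P']
variable (G : PSCDatum P) (H : PSCDatum P') (β : (P ⧸ G.unrKer) ≃ₜ* (P' ⧸ H.unrKer))

/-- **[CombGC] Theorem 1.6 (iii), necessity, OVER THE COVERING DATA** — the landed assembly
`isUnrGroupTheoreticallyVerticial_of_isUnrVerticiallyFiltrationPreserving` with its level-wise binders
`hRC` (G-w5d174-2) and `hVC` (G-w5d174-1) DISCHARGED: for sturdy `G`, `H` on profinite groups with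
`Σ_G = Σ_H = {l}`, granted — for the covering datum of every level `U ⊇ Ker(Π ↠ Π^unr)` of `G` and of
`H` — abc-iut-L3-t4's typed [CombGC] Rmk. 1.4.2 `VerticialPureRamificationCount` and abc-iut-w4-d052's
typed [IUTchI] Rmk. 1.2.3 (iv) statements `VertexQuotientCharacterization`, `VertexSetCharacterization`,
`UnrVerticialSplitInjection`, `UnrVertAbOfRank`, together with [CombGC] Rmk. 1.1.3 (`AbelianizedGrphRank`)
and the connectivity bound `i ≤ n + 1` for `Π^unr`-coverings (G-w5d174-3), every verticially
filtration-preserving `β : Π^unr_G ⥲ Π^unr_H` is group-theoretically verticial.  ([IUTchI] Rmk. 1.2.3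
(vii): "necessity follows formally from the characterization of unramified verticial subgroups given in
Remark 1.4.3 and the characterization of verticially purely totally ramified finite étale coverings
given in Remark 1.4.2" — both characterizations "applied to finite étale `Π^unr`-coverings".)
[cite: MochizukiCombGC2007, Thm 1.6(iii) p.14] [cite: Mochizuki2012, IUTchI Rmk 1.2.3(vii) p.43] -/
theorem isUnrGroupTheoreticallyVerticial_of_isUnrVerticiallyFiltrationPreserving_of_coverings
    (hG : G.IsSturdy) (hH : H.IsSturdy) {l : ℕ} (hSG : G.Sigma = {l}) (hSH : H.Sigma = {l})
    (hrkG : G.AbelianizedGrphRank) (hrkH : H.AbelianizedGrphRank)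
    (hcG : ∀ (U : Subgroup P) [U.FiniteIndex] (hU : IsOpen (U : Set P)), G.unrKer ≤ U →
      (G.restrict U hU).VerticialPureRamificationCount)
    (hcH : ∀ (U₁ : Subgroup P') [U₁.FiniteIndex] (hU₁ : IsOpen (U₁ : Set P')), H.unrKer ≤ U₁ →
      (H.restrict U₁ hU₁).VerticialPureRamificationCount)
    (hiG : ∀ U : Subgroup P, IsOpen (U : Set P) → G.unrKer ≤ U → G.vertCount U ≤ G.nodeCount U + 1)
    (hiH : ∀ U₁ : Subgroup P', IsOpen (U₁ : Set P') → H.unrKer ≤ U₁ →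
      H.vertCount U₁ ≤ H.nodeCount U₁ + 1)
    (hVQG : ∀ (U : Subgroup P) [U.FiniteIndex] (hU : IsOpen (U : Set P)), G.unrKer ≤ U →
      (G.restrict U hU).VertexQuotientCharacterization)
    (hVSG : ∀ (U : Subgroup P) [U.FiniteIndex] (hU : IsOpen (U : Set P)), G.unrKer ≤ U →
      (G.restrict U hU).VertexSetCharacterization)
    (hSIG : ∀ (U : Subgroup P) [U.FiniteIndex] (hU : IsOpen (U : Set P)), G.unrKer ≤ U →
      (G.restrict U hU).UnrVerticialSplitInjection)
    (hRKG : ∀ (U : Subgroup P) [U.FiniteIndex] (hU : IsOpen (U : Set P)), G.unrKer ≤ U →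
      (G.restrict U hU).UnrVertAbOfRank)
    (hVQH : ∀ (U₁ : Subgroup P') [U₁.FiniteIndex] (hU₁ : IsOpen (U₁ : Set P')), H.unrKer ≤ U₁ →
      (H.restrict U₁ hU₁).VertexQuotientCharacterization)
    (hVSH : ∀ (U₁ : Subgroup P') [U₁.FiniteIndex] (hU₁ : IsOpen (U₁ : Set P')), H.unrKer ≤ U₁ →
      (H.restrict U₁ hU₁).VertexSetCharacterization)
    (hSIH : ∀ (U₁ : Subgroup P') [U₁.FiniteIndex] (hU₁ : IsOpen (U₁ : Set P')), H.unrKer ≤ U₁ →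
      (H.restrict U₁ hU₁).UnrVerticialSplitInjection)
    (hRKH : ∀ (U₁ : Subgroup P') [U₁.FiniteIndex] (hU₁ : IsOpen (U₁ : Set P')), H.unrKer ≤ U₁ →
      (H.restrict U₁ hU₁).UnrVertAbOfRank)
    (hβ : G.IsUnrVerticiallyFiltrationPreserving H β) :
    G.IsUnrGroupTheoreticallyVerticial H β :=
  G.isUnrGroupTheoreticallyVerticial_of_isUnrVerticiallyFiltrationPreserving H β hG hH hSG hSH hrkG hrkH
    (G.verticialPureRamificationCount_levels_of_restrict hcG)
    (H.verticialPureRamificationCount_levels_of_restrict hcH) hiG hiH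
    (G.vertexStabilizerCharacterization_levels_of_restrict hVQG hVSG hSIG hRKG)
    (H.vertexStabilizerCharacterization_levels_of_restrict hVQH hVSH hSIH hRKH) hβ

/-- The same as the TYPED ROW PREDICATE `UnrVerticiallyFiltrationPreservingIffVerticial` ([CombGC]
Thm. 1.6 (iii) for `(G, H, β)`), over the covering data. [cite: MochizukiCombGC2007, Thm 1.6(iii) p.13] -/
theorem unrVerticiallyFiltrationPreservingIffVerticial_of_coverings {l : ℕ} (hSG : G.Sigma = {l})
    (hSH : H.Sigma = {l}) (hrkG : G.AbelianizedGrphRank) (hrkH : H.AbelianizedGrphRank)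
    (hcG : ∀ (U : Subgroup P) [U.FiniteIndex] (hU : IsOpen (U : Set P)), G.unrKer ≤ U →
      (G.restrict U hU).VerticialPureRamificationCount)
    (hcH : ∀ (U₁ : Subgroup P') [U₁.FiniteIndex] (hU₁ : IsOpen (U₁ : Set P')), H.unrKer ≤ U₁ →
      (H.restrict U₁ hU₁).VerticialPureRamificationCount)
    (hiG : ∀ U : Subgroup P, IsOpen (U : Set P) → G.unrKer ≤ U → G.vertCount U ≤ G.nodeCount U + 1)
    (hiH : ∀ U₁ : Subgroup P', IsOpen (U₁ : Set P') → H.unrKer ≤ U₁ →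
      H.vertCount U₁ ≤ H.nodeCount U₁ + 1)
    (hVQG : ∀ (U : Subgroup P) [U.FiniteIndex] (hU : IsOpen (U : Set P)), G.unrKer ≤ U →
      (G.restrict U hU).VertexQuotientCharacterization)
    (hVSG : ∀ (U : Subgroup P) [U.FiniteIndex] (hU : IsOpen (U : Set P)), G.unrKer ≤ U →
      (G.restrict U hU).VertexSetCharacterization)
    (hSIG : ∀ (U : Subgroup P) [U.FiniteIndex] (hU : IsOpen (U : Set P)), G.unrKer ≤ U →
      (G.restrict U hU).UnrVerticialSplitInjection)
    (hRKG : ∀ (U : Subgroup P) [U.FiniteIndex] (hU : IsOpen (U : Set P)), G.unrKer ≤ U →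
      (G.restrict U hU).UnrVertAbOfRank)
    (hVQH : ∀ (U₁ : Subgroup P') [U₁.FiniteIndex] (hU₁ : IsOpen (U₁ : Set P')), H.unrKer ≤ U₁ →
      (H.restrict U₁ hU₁).VertexQuotientCharacterization)
    (hVSH : ∀ (U₁ : Subgroup P') [U₁.FiniteIndex] (hU₁ : IsOpen (U₁ : Set P')), H.unrKer ≤ U₁ →
      (H.restrict U₁ hU₁).VertexSetCharacterization)
    (hSIH : ∀ (U₁ : Subgroup P') [U₁.FiniteIndex] (hU₁ : IsOpen (U₁ : Set P')), H.unrKer ≤ U₁ →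
      (H.restrict U₁ hU₁).UnrVerticialSplitInjection)
    (hRKH : ∀ (U₁ : Subgroup P') [U₁.FiniteIndex] (hU₁ : IsOpen (U₁ : Set P')), H.unrKer ≤ U₁ →
      (H.restrict U₁ hU₁).UnrVertAbOfRank) :
    G.UnrVerticiallyFiltrationPreservingIffVerticial H β := fun hG hH =>
  ⟨fun hβ => G.isUnrGroupTheoreticallyVerticial_of_isUnrVerticiallyFiltrationPreserving_of_coverings H β
      hG hH hSG hSH hrkG hrkH hcG hcH hiG hiH hVQG hVSG hSIG hRKG hVQH hVSH hSIH hRKH hβ,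
    fun h => Literature.IUT.HodgeTheaters.Rmk123.isUnrVerticiallyFiltrationPreserving_of_isUnrGroupTheoreticallyVerticial
      G H β h⟩

end Thm16iii

end PSCDatum

end Literature.AnabelianGeometry.SemiGraphs

end
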